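import Summits.AtomisticToContinuum.BoseEinsteinCondensation.Theorems.BECConjugateDominationHardCoreExtensionAlphaPhys
import Summits.AtomisticToContinuum.BoseEinsteinCondensation.Theorems.BECConjugateDominationHardCoreExtensionPairCutoff
import Summits.AtomisticToContinuum.BoseEinsteinCondensation.Theorems.BECConjugateDominationHardCoreExtensionKineticTightness
import Summits.AtomisticToContinuum.BoseEinsteinCondensation.Theorems.BECConjugateDominationHardCoreExtensionPairShellMass
import Literature.MathematicalPhysics.QuantumManyBody.BoseGasThermodynamicLimitRuelle
import HarnessLib

/-!
# Truncation energy convergence at hard cores — UNCONDITIONAL (line `third-law-current-floor`, crux `HardCoreExtension`,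
# stmt-AtomisticToContinuum-11786, lead c1)

The composition node `stub_truncationEnergyConvergencePhys_of` (…AlphaPhys.lean) fed with the three landed analytic stubs
E2 `stub_pairCutoffExists` (PairCutoff.lean), P3 `stub_truncationMinimisersKineticTightness` (KineticTightness.lean) and
P4 `stub_pairShellMassBoundV2` (PairShellMass.lean): for every admissible `v` with `v = ⊤` on `[0,a)` and `v ≤ M < ⊤` on
`(a,∞)`, every `N`, every `L > 4a` with `E₀(v,N,L) < ⊤` and every `ε > 0`, `E₀(v,N,L) ≤ E₀(min(v,n),N,L) + ε` for all large
`n` — in particular for `hardCorePotential a` itself. No form-core, trace or capacity theorem is used. [folklore; the Lean route is new]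
-/

noncomputable section

namespace Summit.AtomisticToContinuum.BoseEinsteinCondensation.Cruxes.HardCoreExtension.ThirdLawCurrentFloor

open MeasureTheory Filter
open scoped ENNReal NNReal BigOperators Topology
open Literature.MathematicalPhysics.QuantumManyBody.BoseGas

/-- **Truncation energy convergence from below at hard-core-type potentials (unconditional; registered
`stub_truncationEnergyConvergencePhys`).** [folklore] -/
theorem stub_truncationEnergyConvergencePhys :
    ∀ (v : ℝ → ℝ≥0∞) (a : ℝ) (M : ℝ≥0∞), IsRepulsiveFiniteRange v → 0 < a →
      (∀ r, 0 ≤ r → r < a → v r = ⊤) → M ≠ ⊤ → (∀ r, a < r → v r ≤ M) →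
      ∀ (N : ℕ) (L : ℝ), 4 * a < L → periodicGroundStateEnergy v N L ≠ ⊤ →
      ∀ ε : ℝ, 0 < ε → ∃ n₀ : ℕ, ∀ n : ℕ, n₀ ≤ n →
        periodicGroundStateEnergy v N L ≤
          periodicGroundStateEnergy (fun r => min (v r) (n : ℝ≥0∞)) N L + ENNReal.ofReal ε :=
  stub_truncationEnergyConvergencePhys_of stub_pairCutoffExists stub_truncationMinimisersKineticTightness
    stub_pairShellMassBoundV2

/-- **The hard-core potential itself**: `E₀(hardCorePotential a, N, L) ≤ E₀(min(hardCorePotential a, n), N, L) + ε` for all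
large `n`, whenever `L > 4a > 0` and the hard-core energy is finite. [folklore] -/
theorem truncationEnergyConvergence_hardCorePotential {a : ℝ} (ha : 0 < a) (N : ℕ) {L : ℝ} (hL : 4 * a < L)
    (hE : periodicGroundStateEnergy (hardCorePotential a) N L ≠ ⊤) {ε : ℝ} (hε : 0 < ε) :
    ∃ n₀ : ℕ, ∀ n : ℕ, n₀ ≤ n →
      periodicGroundStateEnergy (hardCorePotential a) N L ≤
        periodicGroundStateEnergy (fun r => min (hardCorePotential a r) (n : ℝ≥0∞)) N L + ENNReal.ofReal ε :=
  stub_truncationEnergyConvergencePhys (hardCorePotential a) a 0 (isRepulsiveFiniteRange_hardCorePotential a) ha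
    (fun _ _ hr => hardCorePotential_of_lt hr) ENNReal.zero_ne_top
    (fun _ hr => (hardCorePotential_of_le hr.le).le) N L hL hE ε hε

end Summit.AtomisticToContinuum.BoseEinsteinCondensation.Cruxes.HardCoreExtension.ThirdLawCurrentFloor

end
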